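import Summits.CriticalPhenomena.PercolationContinuityZ3.Theorems.FK.OSSSCylinderConditioning
import HarnessLib

/-!
# The monotone two-history coupling along a decision tree: recursions, the diagonal, and monotonicity in the
# second history (toolkit for the OSSS inequality for monotonic measures)

Claimed R42 (8)(c) in the cell INBOX at 2026-08-28T01:24:06Z by fkp-10a gen 352 (NEW CLAIM #1 of the gen) under provision (ι) (no coordinator fk-4 seated since gen 263 closed, cell INBOX l.8248; the lane lead absorbs the registry word; silence = consent; a seated coordinator's word would govern); lineage row FO-10a-g352 (self-suggested), package g352-osss, label OS-B.
Support file of the `fk-continuity` cell (lineage fkp-10a, `--supports stmt-CriticalPhenomena-4575`); builds on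
p205010 (kernel theorem, internal audit signed; external expert review pending).  No definitions, no named facts,
no sorries; standard axioms.  GENERIC finite-probability-space theory (any finite index type `ι`; no lattice, no `d`,
no `q`): the decision-tree input of the OSSS / sharpness programme for the random-cluster model
(Duminil-Copin–Raoufi–Tassion 2019, Thm 1.2), whose instantiation to the wired FK box measures on `ℤ^d` is the
business of the later files of package `g352-osss`.

Setting of `OSSSCylinderConditioning.lean` (`μ > 0` with the FKG lattice condition on `ι → Bool`; cylinder weights
`w D ξ`, masses `Z`, one-edge conditional probabilities `Pr`, conditional expectations `Eg` of a fixed increasing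
`g ≥ 0`, all VARIABLES pinned by their defining equations) plus a reduced decision tree (`DecTree`,
O'Donnell–Saks–Schramm–Servedio).  THE COUPLED FUNCTIONAL `Sh t D ξ ξ'` = `E[F(X) g(Y)]`, where the tree `t` is run on
`X ~ μ(· | ξ_D)` and a second configuration `Y` is built along THE SAME QUERY ORDER from the conditional laws of
`μ(· | ξ'_D, its own history)`, the two bits at each query coupled MONOTONICALLY (optimal coupling of two Bernoulli
laws with success probabilities `α, α'`: weights `min(α,α')`, `1 − max(α,α')`, `(α−α')⁺`, `(α'−α)⁺` on `11, 00, 10, 01`),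
and `Y` completed at the leaf from `μ(· | ξ'_{D'})` (contributing `v · E[g | ξ'_{D'}]`).  `Sh` is a VARIABLE pinned
by this recursion (`hSh0`, `hSh1`); the consumer instantiates it by `DecTree.rec` (no definitions in this file).
Proved: descent of the output bounds `0 ≤ F ≤ M` and of the "variables avoid the history" condition to the subtrees
of a reduced node; the scalar identities of the monotone coupling (`(a−b)⁺ = a − min(a,b)`,
`1 − max(a,b) = 1 − a − b + min(a,b)`, `min(a,b) − ab ≤ b(1−b)` on `[0,1]`; `ab ≤ min(a,b)` is the Literature's `mul_le_min_of_le_one`, inlined where used); the towers for `E[F|ξ]`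
(`ef_tower`) and for the revealment `δ_j(t|ξ) = μ(t queries j | ξ_D)` (`dl_tower`); THE DIAGONAL `sh_diag`
(`Sh t D ξ ξ = E[F g | ξ_D]`: equal histories stay equal); and MONOTONICITY IN THE SECOND HISTORY `sh_mono_right`:
for `ξ₀ ≤ ξ₁`, `0 ≤ Sh t D ξ ξ₁ − Sh t D ξ ξ₀ ≤ M (E[g|ξ₁] − E[g|ξ₀])` (Holley: the `Y`-laws are ordered, and the
monotone coupling tables for `α₀ ≤ α₁` differ by a nonnegative transfer of mass towards the `1`-column).
Finite sums only.

## References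
* H. Duminil-Copin, A. Raoufi, V. Tassion, *Sharp phase transition for the random-cluster and Potts models via decision
  trees*, Ann. of Math. 189 (2019) 75–99, §2 (proof of Thm 1.1), Rmk 2.2. [DuminilCopinRaoufiTassion2019]
* R. O'Donnell, M. Saks, O. Schramm, R. Servedio, *Every decision tree has an influential variable*, FOCS 2005, §3.
  [OdonnellEtAl2005]
* G. Grimmett, *The Random-Cluster Model*, Springer 2006, §2.2 Thm (2.24). [Grimmett2006]
-/

namespace Summit.CriticalPhenomena.PercolationContinuityZ3.Theorems.FK

namespace MonotonicOSSS

open Finset Function Literature.Probability.ODonnellSaksSchrammServedio2005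

variable {ι : Type*} [Fintype ι] [DecidableEq ι]

/-! ### Decision-tree plumbing -/

omit [Fintype ι] in
/-- A subtree not containing `i` does not read coordinate `i`. [cite: OdonnellEtAl2005, §3.2 (reduced trees)] -/
theorem eval_update_of_notMem_vars {t : DecTree ι} {i : ι} (h : i ∉ t.vars) (x : ι → Bool) (c : Bool) :
    t.eval (update x i c) = t.eval x := by
  induction t with
  | leaf v => simp [DecTree.eval]
  | node j t₀ t₁ ih₀ ih₁ =>
    simp only [DecTree.vars, Finset.mem_insert, Finset.mem_union, not_or] at h
    obtain ⟨hij, h₀, h₁⟩ := h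
    have hj : update x i c j = x j := update_of_ne (fun e => hij e.symm) _ _
    simp only [DecTree.eval, hj, ih₀ h₀, ih₁ h₁]

omit [Fintype ι] in
/-- The output bound `0 ≤ F ≤ M` descends to the `true`-subtree of a reduced node.
[cite: OdonnellEtAl2005, §3.2 (reduced trees)] -/
theorem eval_bounds_node_true {e : ι} {t₀ t₁ : DecTree ι} (he : e ∉ t₁.vars) {M : ℝ}
    (hF : ∀ x, 0 ≤ (DecTree.node e t₀ t₁).eval x ∧ (DecTree.node e t₀ t₁).eval x ≤ M) (x : ι → Bool) :
    0 ≤ t₁.eval x ∧ t₁.eval x ≤ M := by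
  have h := hF (update x e true)
  simp only [DecTree.eval, update_self, if_true] at h
  rwa [eval_update_of_notMem_vars he] at h

omit [Fintype ι] in
/-- The output bound `0 ≤ F ≤ M` descends to the `false`-subtree of a reduced node.
[cite: OdonnellEtAl2005, §3.2 (reduced trees)] -/
theorem eval_bounds_node_false {e : ι} {t₀ t₁ : DecTree ι} (he : e ∉ t₀.vars) {M : ℝ}
    (hF : ∀ x, 0 ≤ (DecTree.node e t₀ t₁).eval x ∧ (DecTree.node e t₀ t₁).eval x ≤ M) (x : ι → Bool) :
    0 ≤ t₀.eval x ∧ t₀.eval x ≤ M := by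
  have h := hF (update x e false)
  simp only [DecTree.eval, update_self] at h
  rwa [eval_update_of_notMem_vars he] at h

omit [Fintype ι] in
/-- Variables of the subtrees of a reduced node avoid the enlarged history `D ∪ {e}`.
[cite: OdonnellEtAl2005, §3.2 (reduced trees)] -/
theorem vars_sub_notMem_insert {e : ι} {t t₀ t₁ : DecTree ι} (ht : t = t₀ ∨ t = t₁) (he : e ∉ t.vars)
    {D : Finset ι} (hvars : ∀ i ∈ (DecTree.node e t₀ t₁).vars, i ∉ D) : ∀ i ∈ t.vars, i ∉ insert e D := by
  intro i hi
  rw [Finset.mem_insert, not_or]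
  refine ⟨fun h => he (h ▸ hi), hvars i ?_⟩
  simp only [DecTree.vars, Finset.mem_insert, Finset.mem_union]
  rcases ht with rfl | rfl
  · exact Or.inr (Or.inl hi)
  · exact Or.inr (Or.inr hi)

/-! ### Scalar facts about the monotone coupling of two Bernoulli laws -/

/-- `(a − b)⁺ = a − min(a,b)`. [folklore] -/
theorem max_zero_sub_eq (a b : ℝ) : max 0 (a - b) = a - min a b := by
  rcases le_total a b with h | h
  · rw [min_eq_left h, max_eq_left (by linarith), sub_self]
  · rw [min_eq_right h, max_eq_right (by linarith)]

/-- `1 − max(a,b) = 1 − a − b + min(a,b)`. [folklore] -/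
theorem one_sub_max_eq (a b : ℝ) : 1 - max a b = 1 - a - b + min a b := by
  have := min_add_max a b; linarith

/-- For `a, b ∈ [0,1]`: `min(a,b) − ab ≤ b(1 − b)` (the monotone coupling's excess over independence is at most the
variance of the second bit). [folklore] -/
theorem min_sub_mul_le {a b : ℝ} (hb0 : 0 ≤ b) (hb1 : b ≤ 1) :
    min a b - a * b ≤ b * (1 - b) := by
  rcases le_total a b with h | h
  · rw [min_eq_left h]; nlinarith
  · rw [min_eq_right h]; nlinarith

/-! ### The recursions of `EF`, `Dl` (revealment) and the diagonal -/

variable (μ g : (ι → Bool) → ℝ) (w : Finset ι → (ι → Bool) → (ι → Bool) → ℝ) (Z : Finset ι → (ι → Bool) → ℝ)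
  (Pr : Finset ι → (ι → Bool) → ι → ℝ) (Eg : Finset ι → (ι → Bool) → ℝ)
  (Sh : DecTree ι → Finset ι → (ι → Bool) → (ι → Bool) → ℝ)

/-- TOWER FOR `E[F | ξ_D]` at a node querying `e ∉ D`: `E[F|ξ] = α E[F₁ | ξ^{e→1}] + (1 − α) E[F₀ | ξ^{e→0}]`.
[cite: DuminilCopinRaoufiTassion2019, §2 proof of Thm 1.1 (conditioning on the first query)] -/
theorem ef_tower (hw : ∀ D ξ x, w D ξ x = if (∀ i ∈ D, x i = ξ i) then μ x else 0)
    (hZ : ∀ D ξ, Z D ξ = ∑ x, w D ξ x) (hPr : ∀ D ξ e, Pr D ξ e = Z (insert e D) (update ξ e true) / Z D ξ)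
    (hμ0 : ∀ x, 0 < μ x) (e : ι) (t₀ t₁ : DecTree ι) {D : Finset ι} (he : e ∉ D) (ξ : ι → Bool) :
    (∑ x, w D ξ x * (DecTree.node e t₀ t₁).eval x) / Z D ξ
      = Pr D ξ e * ((∑ x, w (insert e D) (update ξ e true) x * t₁.eval x) / Z (insert e D) (update ξ e true))
        + (1 - Pr D ξ e) *
          ((∑ x, w (insert e D) (update ξ e false) x * t₀.eval x) / Z (insert e D) (update ξ e false)) := by
  rw [condexp_tower μ w Z Pr hw hZ hPr hμ0 he ξ,
    sum_w_insert_congr μ w hw he ξ true (h' := fun x => t₁.eval x) (fun x hx => by simp [DecTree.eval, hx]),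
    sum_w_insert_congr μ w hw he ξ false (h' := fun x => t₀.eval x) (fun x hx => by simp [DecTree.eval, hx])]

/-- TOWER FOR THE REVEALMENT at a reduced node querying `e ∉ D`:
`δ_j(node | ξ) = 𝟙{j = e} + α δ_j(t₁ | ξ^{e→1}) + (1 − α) δ_j(t₀ | ξ^{e→0})`.
[cite: OdonnellEtAl2005, §1 p. 3 (δ_i = Pr[T queries x_i])] -/
theorem dl_tower (hw : ∀ D ξ x, w D ξ x = if (∀ i ∈ D, x i = ξ i) then μ x else 0)
    (hZ : ∀ D ξ, Z D ξ = ∑ x, w D ξ x) (hPr : ∀ D ξ e, Pr D ξ e = Z (insert e D) (update ξ e true) / Z D ξ)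
    (hμ0 : ∀ x, 0 < μ x) {e : ι} {t₀ t₁ : DecTree ι} (he₀ : e ∉ t₀.vars) (he₁ : e ∉ t₁.vars) {D : Finset ι}
    (he : e ∉ D) (ξ : ι → Bool) (j : ι) :
    (∑ x, w D ξ x * (if j ∈ (DecTree.node e t₀ t₁).queried x then 1 else 0)) / Z D ξ
      = (if j = e then 1 else 0)
        + Pr D ξ e * ((∑ x, w (insert e D) (update ξ e true) x * (if j ∈ t₁.queried x then 1 else 0))
            / Z (insert e D) (update ξ e true))
        + (1 - Pr D ξ e) * ((∑ x, w (insert e D) (update ξ e false) x * (if j ∈ t₀.queried x then 1 else 0))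
            / Z (insert e D) (update ξ e false)) := by
  have hZ0 := (Z_pos μ w Z hw hZ hμ0 D ξ).ne'
  -- split the indicator pointwise
  have hsplit : ∀ x : ι → Bool, (if j ∈ (DecTree.node e t₀ t₁).queried x then (1 : ℝ) else 0)
      = (if j = e then (1 : ℝ) else 0)
        + (if x e = true then (if j ∈ t₁.queried x then (1 : ℝ) else 0)
            else (if j ∈ t₀.queried x then (1 : ℝ) else 0)) := by
    intro x
    by_cases hje : j = e
    · subst hje
      have h1 : j ∉ t₁.queried x := fun h => he₁ (DecTree.queried_subset_vars _ _ h)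
      have h0 : j ∉ t₀.queried x := fun h => he₀ (DecTree.queried_subset_vars _ _ h)
      simp [DecTree.queried, h1, h0]
    · simp only [DecTree.queried, Finset.mem_insert, hje, false_or, if_false, zero_add]
      split_ifs <;> simp_all
  simp_rw [hsplit, mul_add, Finset.sum_add_distrib, add_div]
  rw [← Finset.sum_mul, ← hZ, mul_comm (Z D ξ), mul_div_assoc, div_self hZ0, mul_one,
    condexp_tower μ w Z Pr hw hZ hPr hμ0 he ξ, add_assoc,
    sum_w_insert_congr μ w hw he ξ true (h' := fun x => if j ∈ t₁.queried x then (1 : ℝ) else 0)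
      (fun x hx => by rw [if_pos hx]),
    sum_w_insert_congr μ w hw he ξ false (h' := fun x => if j ∈ t₀.queried x then (1 : ℝ) else 0)
      (fun x hx => by simp [hx])]

/-- THE DIAGONAL: started from equal histories the monotone coupling keeps `Y = X` on every queried coordinate, so
`Sh t D ξ ξ = E[F g | ξ_D]`. [cite: DuminilCopinRaoufiTassion2019, §2 proof of Thm 1.1 (f(Y⁰) = f(X))] -/
theorem sh_diag (hw : ∀ D ξ x, w D ξ x = if (∀ i ∈ D, x i = ξ i) then μ x else 0)
    (hZ : ∀ D ξ, Z D ξ = ∑ x, w D ξ x) (hPr : ∀ D ξ e, Pr D ξ e = Z (insert e D) (update ξ e true) / Z D ξ)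
    (hEg : ∀ D ξ, Eg D ξ = (∑ x, w D ξ x * g x) / Z D ξ) (hμ0 : ∀ x, 0 < μ x)
    (hSh0 : ∀ v D ξ ξ', Sh (DecTree.leaf v) D ξ ξ' = v * Eg D ξ')
    (hSh1 : ∀ e t₀ t₁ D ξ ξ', Sh (DecTree.node e t₀ t₁) D ξ ξ' =
        min (Pr D ξ e) (Pr D ξ' e) * Sh t₁ (insert e D) (update ξ e true) (update ξ' e true)
      + (1 - max (Pr D ξ e) (Pr D ξ' e)) * Sh t₀ (insert e D) (update ξ e false) (update ξ' e false)
      + max 0 (Pr D ξ e - Pr D ξ' e) * Sh t₁ (insert e D) (update ξ e true) (update ξ' e false)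
      + max 0 (Pr D ξ' e - Pr D ξ e) * Sh t₀ (insert e D) (update ξ e false) (update ξ' e true)) :
    ∀ t : DecTree ι, t.Reduced → ∀ (D : Finset ι) (ξ : ι → Bool), (∀ i ∈ t.vars, i ∉ D) →
      Sh t D ξ ξ = (∑ x, w D ξ x * (t.eval x * g x)) / Z D ξ := by
  intro t
  induction t with
  | leaf v =>
    intro _ D ξ _
    rw [hSh0, hEg, mul_div_assoc', Finset.mul_sum]
    congr 1
    exact Finset.sum_congr rfl fun x _ => by simp only [DecTree.eval]; ring
  | node e t₀ t₁ ih₀ ih₁ =>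
    intro hred D ξ hvars
    simp only [DecTree.Reduced] at hred
    obtain ⟨he₀, he₁, hr₀, hr₁⟩ := hred
    have he : e ∉ D := hvars e (by simp [DecTree.vars])
    rw [hSh1, min_self, max_self, sub_self, max_self, zero_mul, zero_mul, add_zero, add_zero,
      ih₁ hr₁ _ _ (vars_sub_notMem_insert (Or.inr rfl) he₁ hvars),
      ih₀ hr₀ _ _ (vars_sub_notMem_insert (Or.inl rfl) he₀ hvars),
      condexp_tower μ w Z Pr hw hZ hPr hμ0 he ξ (fun x => (DecTree.node e t₀ t₁).eval x * g x),
      sum_w_insert_congr μ w hw he ξ true (h := fun x => (DecTree.node e t₀ t₁).eval x * g x)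
        (h' := fun x => t₁.eval x * g x) (fun x hx => by simp [DecTree.eval, hx]),
      sum_w_insert_congr μ w hw he ξ false (h := fun x => (DecTree.node e t₀ t₁).eval x * g x)
        (h' := fun x => t₀.eval x * g x) (fun x hx => by simp [DecTree.eval, hx])]

/-! ### Monotonicity of the coupled functional in the second history -/

/-- RAISING `Y`'S HISTORY RAISES `E[F(X) g(Y)]`, BY AT MOST `M` TIMES THE GAIN IN `E[g]`: for `ξ₀ ≤ ξ₁`,
`0 ≤ Sh t D ξ ξ₁ − Sh t D ξ ξ₀ ≤ M (E[g|ξ₁] − E[g|ξ₀])` (`0 ≤ F ≤ M`, `g ≥ 0` increasing).  Induction on the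
tree: the monotone coupling tables for `Y`-laws `α₀ ≤ α₁` (Holley) differ by a nonnegative transfer of mass from the
`0`-column to the `1`-column. [cite: DuminilCopinRaoufiTassion2019, §2 Rmk 2.2 (F is increasing in u and in μ)] -/
theorem sh_mono_right (hw : ∀ D ξ x, w D ξ x = if (∀ i ∈ D, x i = ξ i) then μ x else 0)
    (hZ : ∀ D ξ, Z D ξ = ∑ x, w D ξ x) (hPr : ∀ D ξ e, Pr D ξ e = Z (insert e D) (update ξ e true) / Z D ξ)
    (hEg : ∀ D ξ, Eg D ξ = (∑ x, w D ξ x * g x) / Z D ξ) (hμ0 : ∀ x, 0 < μ x)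
    (hμ : ∀ a b, μ a * μ b ≤ μ (a ⊓ b) * μ (a ⊔ b)) (hg0 : ∀ x, 0 ≤ g x) (hg : Monotone g)
    (hSh0 : ∀ v D ξ ξ', Sh (DecTree.leaf v) D ξ ξ' = v * Eg D ξ')
    (hSh1 : ∀ e t₀ t₁ D ξ ξ', Sh (DecTree.node e t₀ t₁) D ξ ξ' =
        min (Pr D ξ e) (Pr D ξ' e) * Sh t₁ (insert e D) (update ξ e true) (update ξ' e true)
      + (1 - max (Pr D ξ e) (Pr D ξ' e)) * Sh t₀ (insert e D) (update ξ e false) (update ξ' e false)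
      + max 0 (Pr D ξ e - Pr D ξ' e) * Sh t₁ (insert e D) (update ξ e true) (update ξ' e false)
      + max 0 (Pr D ξ' e - Pr D ξ e) * Sh t₀ (insert e D) (update ξ e false) (update ξ' e true)) {M : ℝ} :
    ∀ t : DecTree ι, t.Reduced → (∀ x, 0 ≤ t.eval x ∧ t.eval x ≤ M) →
      ∀ (D : Finset ι) (ξ ξ₀ ξ₁ : ι → Bool), (∀ i ∈ t.vars, i ∉ D) → ξ₀ ≤ ξ₁ →
        0 ≤ Sh t D ξ ξ₁ - Sh t D ξ ξ₀ ∧ Sh t D ξ ξ₁ - Sh t D ξ ξ₀ ≤ M * (Eg D ξ₁ - Eg D ξ₀) := by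
  intro t
  induction t with
  | leaf v =>
    intro _ hF D ξ ξ₀ ξ₁ _ h01
    have hv : 0 ≤ v ∧ v ≤ M := by simpa [DecTree.eval] using hF (fun _ => false)
    have hE : Eg D ξ₀ ≤ Eg D ξ₁ := Eg_mono μ g w Z Eg hw hZ hEg hμ0 hμ hg0 hg D h01
    rw [hSh0, hSh0, ← mul_sub]
    exact ⟨mul_nonneg hv.1 (sub_nonneg.2 hE), mul_le_mul_of_nonneg_right hv.2 (sub_nonneg.2 hE)⟩
  | node e t₀ t₁ ih₀ ih₁ =>
    intro hred hF D ξ ξ₀ ξ₁ hvars h01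
    simp only [DecTree.Reduced] at hred
    obtain ⟨he₀, he₁, hr₀, hr₁⟩ := hred
    have he : e ∉ D := hvars e (by simp [DecTree.vars])
    have hv₀ := vars_sub_notMem_insert (Or.inl rfl) he₀ hvars
    have hv₁ := vars_sub_notMem_insert (Or.inr rfl) he₁ hvars
    have hF₀ := eval_bounds_node_false he₀ hF
    have hF₁ := eval_bounds_node_true he₁ hF
    -- the six inductive facts
    have I1t := ih₁ hr₁ hF₁ (insert e D) (update ξ e true) (update ξ₀ e true) (update ξ₁ e true) hv₁
      (update_le_update_of_le h01 e true)
    have I1f := ih₁ hr₁ hF₁ (insert e D) (update ξ e true) (update ξ₀ e false) (update ξ₁ e false) hv₁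
      (update_le_update_of_le h01 e false)
    have I0t := ih₀ hr₀ hF₀ (insert e D) (update ξ e false) (update ξ₀ e true) (update ξ₁ e true) hv₀
      (update_le_update_of_le h01 e true)
    have I0f := ih₀ hr₀ hF₀ (insert e D) (update ξ e false) (update ξ₀ e false) (update ξ₁ e false) hv₀
      (update_le_update_of_le h01 e false)
    have J1 := ih₁ hr₁ hF₁ (insert e D) (update ξ e true) (update ξ₀ e false) (update ξ₀ e true) hv₁
      (update_false_le_update_true ξ₀ e)
    have J0 := ih₀ hr₀ hF₀ (insert e D) (update ξ e false) (update ξ₀ e false) (update ξ₀ e true) hv₀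
      (update_false_le_update_true ξ₀ e)
    -- towers for `E[g | ξ_i]`
    rw [Eg_tower μ g w Z Pr Eg hw hZ hPr hEg hμ0 he ξ₁, Eg_tower μ g w Z Pr Eg hw hZ hPr hEg hμ0 he ξ₀, hSh1, hSh1]
    -- scalars
    have hα := Pr_pos μ w Z Pr hw hZ hPr hμ0 D ξ e
    have hα' := Pr_lt_one μ w Z Pr hw hZ hPr hμ0 he ξ
    have hα₀ := Pr_pos μ w Z Pr hw hZ hPr hμ0 D ξ₀ e
    have hα₀' := Pr_lt_one μ w Z Pr hw hZ hPr hμ0 he ξ₀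
    have hα₁ := Pr_pos μ w Z Pr hw hZ hPr hμ0 D ξ₁ e
    have hα₁' := Pr_lt_one μ w Z Pr hw hZ hPr hμ0 he ξ₁
    have h01α : Pr D ξ₀ e ≤ Pr D ξ₁ e := Pr_mono μ w Z Pr hw hZ hPr hμ0 hμ he h01
    set α := Pr D ξ e
    set α₀ := Pr D ξ₀ e
    set α₁ := Pr D ξ₁ e
    -- the `(α_i − α)⁺` coefficients before rewriting through `min`
    have hcf : max 0 (α₀ - α) ≤ max 0 (α₁ - α) := max_le_max le_rfl (sub_le_sub_right h01α α)
    rw [max_zero_sub_eq α α₁, max_zero_sub_eq α α₀, one_sub_max_eq α α₁, one_sub_max_eq α α₀]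
    rw [max_zero_sub_eq α₁ α, max_zero_sub_eq α₀ α, min_comm α₁ α, min_comm α₀ α] at hcf ⊢
    set m₀ := min α α₀
    set m₁ := min α α₁
    have hm : m₀ ≤ m₁ := min_le_min le_rfl h01α
    have hm₁a : m₁ ≤ α := min_le_left _ _
    have hm₁b : m₁ ≤ α₁ := min_le_right _ _
    have hm₁c : 0 ≤ 1 - α - α₁ + m₁ := by
      rw [← one_sub_max_eq]; exact sub_nonneg.2 (max_le hα'.le hα₁'.le)
    have hm₀0 : 0 ≤ m₀ := le_min hα.le hα₀.le
    -- products: coefficient × inductive fact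
    have P1 := mul_nonneg (hm₀0.trans hm) I1t.1
    have P1' := mul_le_mul_of_nonneg_left I1t.2 (hm₀0.trans hm)
    have P2 := mul_nonneg (sub_nonneg.2 hm₁a) I1f.1
    have P2' := mul_le_mul_of_nonneg_left I1f.2 (sub_nonneg.2 hm₁a)
    have P3 := mul_nonneg (sub_nonneg.2 hm) J1.1
    have P3' := mul_le_mul_of_nonneg_left J1.2 (sub_nonneg.2 hm)
    have P4 := mul_nonneg (sub_nonneg.2 hm₁b) I0t.1
    have P4' := mul_le_mul_of_nonneg_left I0t.2 (sub_nonneg.2 hm₁b)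
    have P5 := mul_nonneg hm₁c I0f.1
    have P5' := mul_le_mul_of_nonneg_left I0f.2 hm₁c
    have P6 := mul_nonneg (sub_nonneg.2 hcf) J0.1
    have P6' := mul_le_mul_of_nonneg_left J0.2 (sub_nonneg.2 hcf)
    constructor
    · linarith [P1, P2, P3, P4, P5, P6]
    · linarith [P1', P2', P3', P4', P5', P6']

end MonotonicOSSS

end Summit.CriticalPhenomena.PercolationContinuityZ3.Theorems.FK
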